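import Summits.HodgeConjecture.HodgeConjecture.Cruxes.H413.Lines.R90_S2_ArchPacketXiA   -- S2 file A ΞA (BUILT BW149): Σ∞-ι `R90.S2.ArchPacketIotaLetter`∕`ArchMemberIota`, `R90.S2.isCohTrivial_of_mem_posited`, Σ∞-cpt `R90.S2.stub_R90_S2_archPacketCompact`; carries ★ K1 `F0P3cPinCompactChi`, ★ `F0P3CompactTrivOfRecord`, ★ «Tok» `F0P3SLayerFoldShapes`, ★ `F0P3XiArchDataOfRecord`, the LH1 leaf `F0_P3c_S2SharpPaydown` (organ Ξ∞ `S2QpsiLetter`)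
import HarnessLib

/-!
# R90-TF · S7 «§14.6» — FILE D «ARCH ι-LOCUS», EDITION 1 (SOCKET + HEAD): `stub_R90_S7_xiIotaLocus : XiIotaLocusLetter` — Rogawski's archimedean input AT THE PLACE OF `ι`,
# re-typed SIGN-FREE and CLASS-FREE in ξ-PARAMETER currency («a cotangent member `P` of the ξ-family forces `ξ_ι` onto the cohomological locus `φ(ξ_ι) = φ(1,0,−1)`»),
# and the head `R90.S7.s2Qpsi_paid : S2QpsiLetter` = organ Ξ∞ of the LH1 leaf BY NAME from {S7 «ι-LOCUS», S2 Σ∞-cpt}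
# ([Rogawski1990, §14.6 Thm. 14.6.4 p. 243; §13.3 Thm. 13.3.5, Thm. 13.3.6 (c) p. 202; §12.3 Prop. 12.3.3 p. 178; Prop. 15.2.1 (b) p. 249]; [BorelWallach2000, VI Thm. 4.11]; [Marshall2014, §3.3 ¶3, §3.4 ¶1])

Cell `hodgecm-mathlib`, crux H413 (`stmt-HodgeConjecture-24833`), route of record `HCCMUnconditional`; programme R90-TF (brief `director/R90-BRIEF.v2.md` 1f40d54518340a35),
section S7 = Rogawski §14.6 (base `R90-C146`); dealer∕pen LH7-plan (g5) RULING S7-R19 + HEADS OF RECORD `F0/P3c/LH7/LH7-plan/g5/HEADS-R90S7ArchIotaLocusD.v1.md` b6c08ea55264c2d6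
(on CENSUS D-S7#8 `R90/R90-C146-p01/g2/CENSUS-D-S7-8-ArchMemberIota.v1.C146p01-g2.md` f97e592ed887e582); typed by the prover seat R90-C146-p01 (g2) (DEAL D-S7#9); written by the
S7 pen (`ledger crux write stmt-HodgeConjecture-24833 Lines/R90_S7_ArchIotaLocusD.lean`) after LH7-audit1's box and after «F13 №2 BUILT».

WHAT THIS FILE IS.  The ONLY on-path consumer of S2's archimedean socket Σ∞-ι `R90.S2.stub_R90_S2_archPacketIota : ArchPacketIotaLetter` (`Lines/R90_S2_ArchPacketXiA.lean`
:157) is XiA `s2Qpsi_of_sigmas` :203–:215 (Index R3), and it extracts from `ArchMemberIota jInf dsInf` EXACTLY ONE line (:208): `hι : ξ.IsCohTrivialAt (tOfArchType (archTypeOfRecord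
μω) ι) ι` — the SIGN (which of `J^±` is `πⁿ(ξ_ι)`) and the (𝔤,K)-CLASS of the token are not consumed on the h413 path.  §1 types that line as the letter «ι-LOCUS»
`XiIotaLocusLetter` (binders = the LH1 organ Ξ∞ `F0P3cS2SharpPaydown.S2QpsiLetter` :329–:342 VERBATIM without the `τ` binder; conclusion = the type of XiA :208 token for
token); §2 sockets it (`stub_R90_S7_xiIotaLocus`, THE one `sorry` of this file — PRINT, TF-class: Thm. 14.6.4 ∕ 13.3.6 (c) at `ι` + Prop. 12.3.3 + Prop. 15.2.1 (b)); §3 proves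
the certificate «NOT A STRENGTHENING» (`xiIotaLocus_of_archPacketIota : ArchPacketIotaLetter → XiIotaLocusLetter`, XiA :204–:209 verbatim — AUDIT S2#A1 covers D a fortiori), the
junction `s2Qpsi_of_locus : XiIotaLocusLetter → S2PinCompactLetter → S2QpsiLetter` (XiA :203–:215 with :208 := the letter), the HEAD `s2Qpsi_paid` (Ξ∞ by name ⟸ {S7 «ι-LOCUS»,
S2 Σ∞-cpt}; `#print axioms` = TRIO ∪ `sorryAx` through EXACTLY `stub_R90_S7_xiIotaLocus` and `R90.S2.stub_R90_S2_archPacketCompact`), and the read-back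
`s2Qpsi_of_sigmas_via_locus` (the old road factors through the new letter).  After D is BUILT, Index R3 has a SECOND payer by name (`R90.S7.s2Qpsi_paid`); the re-point is the
Index pen's act in a later Index edition (HEADS §3); on re-point Σ∞-ι becomes a print shell off-path (JQ-S7-7b, parked).

IMPORT LAW (L9-D, HEADS §2): `…Cruxes.H413.Lines.R90_S2_ArchPacketXiA` (to NAME `ArchPacketIotaLetter`, `isCohTrivial_of_mem_posited`, `stub_R90_S2_archPacketCompact`; it carries
★ K1, ★ `F0P3CompactTrivOfRecord`, ★ «Tok», ★ `F0P3XiArchDataOfRecord` and the LH1 leaf transitively) + `HarnessLib` ONLY; NEVER S7 A∕B∕C, never the PK leaf, never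
T-A∕T-B∕AGG∕KitRung0, never the Index — D stays OUTSIDE the F13 №2 cone and outside S7 A∕B's cone; nothing imports D until the Index pen re-points R3.  No instance, no notation,
no `Classical.choose`, no definition with data (one closed `Prop`), exactly ONE `sorry` (§2).

CIRCULARITY GUARD (CENSUS §(4) = RULING S7-R19, binding): the socket's payer is PRINT Ch. 13–14 at `ι` (the S9∕S10 trace-formula road, same class as S9 (B4)
`sock_S9_definiteXiMembership`); it must NEVER be «paid» from the organ Ξ∞ `S2QpsiLetter` ∕ `s2Qpsi_paid` (this file's or XiA's), from the LH1 leaf's `casimirIota_holds` ∕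
`pinCompact_holds` ∕ `casimirTau_holds` (all Ξ∞-dependent), or from anything downstream of `R90.S2.stub_R90_S2_archPacketIota` or of `stub_R90_S7_xiIotaLocus` itself.

## Honest label
A socket PAYS NOTHING until proved; this file RE-TYPES the archimedean input at `ι` strictly weaker (class-free, sign-free) and closes no citation.  HC_CM is proved only
modulo the 7 printed citations (2 remaining named inputs: hLiu418 = stmt-HodgeConjecture-24832, h413 = stmt-HodgeConjecture-24833) until rung 0 closes; count-neutral (a
Lines edition: 0 proposals ∕ 0 registry acts by the typist).

## References
* [Rogawski1990] J. D. Rogawski, *Automorphic Representations of Unitary Groups in Three Variables*, Ann. of Math. Stud. 123 (1990): §14.6 Thm. 14.6.4 p. 243 and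
  pp. 242–243 (`Π′(ξ_v)`); §13.3 Thm. 13.3.5, Thm. 13.3.6 (c) p. 202; §12.3 Prop. 12.3.3 p. 178; §13.1 p. 199; Prop. 15.2.1 (b) p. 249; §15.3 ¶1 p. 249.
* [BorelWallach2000] A. Borel, N. Wallach, *Continuous Cohomology, Discrete Subgroups, and Representations of Reductive Groups*, 2nd ed. (2000): VI Thm. 4.11; I §5.3.
* [Marshall2014] S. Marshall, *Endoscopy and cohomology growth on U(3)*, Compos. Math. 150 (2014): §3.3 ¶3 and ¶5; §3.4 ¶1; §4.1.
-/

set_option autoImplicit false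
-- the mandated namespace repeats the single-problem summit's segment (`HodgeConjecture.HodgeConjecture`)
set_option linter.dupNamespace false

noncomputable section

open NumberField IsDedekindDomain MeasureTheory
open scoped Matrix ComplexOrder

namespace Summit.HodgeConjecture.HodgeConjecture.R90.S7

open Literature.NumberTheory.Automorphic Literature.NumberTheory.Automorphic.UnitaryGroup
open Literature.NumberTheory.Automorphic.UnitaryGroup.CotangentForms
open Literature.NumberTheory.GaloisRepresentations
open Literature.NumberTheory.Rogawski1990
open Literature.RepresentationTheory.BorelWallach2000
open Literature.RepresentationTheory.KonnoKonno2007 Literature.RepresentationTheory.KonnoKonno2007.RealDualPair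
open Literature.RepresentationTheory.KonnoKonno2007.RealDualPair.UForm
open Summit.HodgeConjecture.HodgeConjecture.Cruxes.H413
open Summit.HodgeConjecture.HodgeConjecture.Cruxes.H413.F0P3XiArchDataOfRecord
open Summit.HodgeConjecture.HodgeConjecture.Cruxes.H413.F0P3cPinCompactChi (S2PinCompactLetter)
open Summit.HodgeConjecture.HodgeConjecture.Cruxes.H413.F0P3cS2SharpPaydown (S2QpsiLetter)
open Summit.HodgeConjecture.HodgeConjecture.R90.S2 (ArchPacketIotaLetter isCohTrivial_of_mem_posited)

/-! ## §1 The letter «ι-LOCUS» (a closed `Prop` over existing declarations; frame = Ξ∞'s, binder for binder, without `τ`) -/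

/-- **«ι-LOCUS» `XiIotaLocusLetter` — A COTANGENT MEMBER OF THE ξ-FAMILY FORCES `ξ_ι` ONTO THE COHOMOLOGICAL LOCUS.**  Frame of the LH1 organ Ξ∞ `S2QpsiLetter` VERBATIM
(CM `L`, `[L⁺:ℚ] ≥ 2`, `ι`, `H` with frame `T` at `ι` and positive definite at the complex places not over the place of `ι`, an automorphic measure `μ`, Rogawski's `μω`
unitary with `μω|_{𝕀_{L⁺}} = ω_{L∕L⁺}`, a discrete `P` of holomorphic or antiholomorphic cotangent type at the CM frame, a one-dimensional automorphic `ξ` of `H` with `P` in the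
ξ-local family ★ `MemXiFamily`); CONCLUSION: `ξ_ι` is of cohomological type for trivial coefficients w.r.t. Rogawski's parameter `t = tOfArchType (archTypeOfRecord μω) ι`, i.e.
★ `ξ.IsCohTrivialAt (ArchSignRecipe.tOfArchType (archTypeOfRecord μω) ι) ι` (`φ(ξ_ι ⊗ μ_ι) = φ(1,0,−1)`) — the type of XiA `s2Qpsi_of_sigmas` :208 token for token.
PRINT: `P ∈ Π′(ξ)` [Thm. 14.6.4 with Thm. 13.3.5 ∕ 13.3.6 (c)] gives `P_ι ∈ Π(ξ_ι) = {πⁿ(ξ_ι), πˢ(ξ_ι)}` [Prop. 12.3.3]; `P_ι` carries a non-zero degree-one `(𝔤,K)`-class (cotangent),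
and a member of `Π(ξ_ι)` with `H¹ ≠ 0` exists only for `φ = φ(1,0,−1)` [§12.3 p. 178; Prop. 15.2.1 (b); BW VI Thm. 4.11] («`Π_{v₀}(ξ) ∩ {J⁺, J⁻} = ∅` unless `ξ ∈ Ξ_{v₀}`»,
Marshall §3.3 ¶3).  SIGN-FREE (which of `J^±` is `πⁿ(ξ_ι)` is not asserted) and CLASS-FREE (no (𝔤,K)-carrier is named) — RULING S7-R19 (2′).
WHY IT MIGHT FAIL AS TYPED: only as print fails — Thm. 14.6.4 + Prop. 12.3.3 at `ι`; a cotangent `P` whose (U♭-unique, ★ `memXiFamily_rigid_of_isCot`) `ξ` had `ξ_ι ∉ Ξ_ι` would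
refute it.  RECIPE RISK: the triple `(ξ.pη ι, ξ.qψ ι, tOfArchType (archTypeOfRecord μω) ι)` is the tree's parametrisation of `ξ_ι ⊗ μ_ι` (★ `ArchSignRecipe`, ★ K6 stop-check;
consistency witnesses ★ S5 `R90S5XiMembershipOfArchJOfString` and Σ∞-ι's AUDIT S2#A1).  JUNK TESTS: vacuity — the hypotheses are Ξ∞'s ∕ Σ∞-ι's frame verbatim, satisfiable in
print ((G∞) members exist); junk `ξ` — `MemXiFamily` pins `ξ_v` at almost every finite `v`, so `ξ` is the U♭-unique one, no free parameter; junk `μ` — instance-guarded as in every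
S2 letter.  CONSUMER: §3 `s2Qpsi_of_locus` ∕ `s2Qpsi_paid` (organ Ξ∞ by name); Index R3 on re-point.  CERTIFICATE: §3 `xiIotaLocus_of_archPacketIota` (implied by Σ∞-ι).
[cite: Rogawski1990, §14.6 Thm. 14.6.4 p. 243; §13.3 Thm. 13.3.6 (c) and Thm. 13.3.5 p. 202; §12.3 Prop. 12.3.3 p. 178; Prop. 15.2.1 (b) p. 249] [cite: BorelWallach2000, VI Thm. 4.11] [cite: Marshall2014, §3.3 ¶3; §3.4 ¶1] -/
def XiIotaLocusLetter : Prop :=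
  ∀ (L : Type) [Field L] [NumberField L] [IsCMField L] (ι : L →+* ℂ) (H : Matrix (Fin 3) (Fin 3) L) (T : GL (Fin 3) ℂ)
    (hT : (T : Matrix (Fin 3) (Fin 3) ℂ)ᴴ * H.map ι * (T : Matrix (Fin 3) (Fin 3) ℂ) = Literature.Geometry.ComplexHyperbolic.BallModel.J),
    (∀ τ' : L →+* ℂ, InfinitePlace.mk τ' ≠ InfinitePlace.mk ι → (H.map τ').PosDef) →
    2 ≤ Module.finrank ℚ ↥(maximalRealSubfield L) →
    ∀ (μ : Measure (adelicGroupData (↥(maximalRealSubfield L)) L (IsCMField.complexConj L) 3 H).automorphicQuotient)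
      [(adelicGroupData (↥(maximalRealSubfield L)) L (IsCMField.complexConj L) 3 H).IsAutomorphicMeasure μ]
      (μω : HeckeCharacter L) (hμu : μω.IsUnitary),
      (∀ x : Literature.NumberTheory.GaloisRepresentations.ideleGroup ↥(maximalRealSubfield L),
        μω (AdeleRing.ideleBaseChange (↥(maximalRealSubfield L)) L x) = quadraticHeckeCharCM L x) →
    ∀ (P : DiscreteAutomorphicRep (adelicGroupData (↥(maximalRealSubfield L)) L (IsCMField.complexConj L) 3 H) μ),
      (P.IsHolCotangentAt (cmArchSection L ι H T hT) (cmCompactFactor L ι H T hT) ∨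
        P.IsAntiholCotangentAt (cmArchSection L ι H T hT) (cmCompactFactor L ι H T hT)) →
        ∀ ξ : OneDimAutRepH L,
          MemXiFamily P (transpose_map_cmConjRingHom_eq_of_frame L ι H T hT) (isUnit_det_of_frame L ι H T hT) μω hμu ξ →
            ξ.IsCohTrivialAt (ArchSignRecipe.tOfArchType (archTypeOfRecord μω) ι) ι

/-! ## §2 The socket (REGISTERED STUB — the only `sorry` of this file; paid by name `--supports stmt-HodgeConjecture-24833`) -/

/-- **SOCKET S7#D1 «ι-LOCUS» `stub_R90_S7_xiIotaLocus`** (TF-class PRINT; payer road: Rogawski Ch. 13–14 AT THE PLACE OF `ι` — Thm. 14.6.4 for `U(H)` with Thm. 13.3.5 ∕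
13.3.6 (c) (the S9∕S10 trace-formula road, same class as S9 (B4) `sock_S9_definiteXiMembership`), then Prop. 12.3.3 + Prop. 15.2.1 (b) locally).  CIRCULARITY GUARD
(RULING S7-R19 = CENSUS D-S7#8 §(4), binding): NEVER paid from the organ Ξ∞ `S2QpsiLetter` ∕ `s2Qpsi_paid`, from the LH1 leaf's `casimirIota_holds` ∕ `pinCompact_holds` ∕
`casimirTau_holds` (Ξ∞-dependent), or from anything downstream of `R90.S2.stub_R90_S2_archPacketIota` or of this stub.  SOCKET PAYS NOTHING until proved.
[cite: Rogawski1990, §14.6 Thm. 14.6.4 p. 243; §13.3 Thm. 13.3.5 and Thm. 13.3.6 (c) p. 202; §12.3 Prop. 12.3.3 p. 178; Prop. 15.2.1 (b) p. 249] [cite: Marshall2014, §3.3 ¶3] -/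
theorem stub_R90_S7_xiIotaLocus : XiIotaLocusLetter := by
  sorry

/-! ## §3 Certificate, junction, head, read-back (PROVED; logic + ★) -/

/-- **CERTIFICATE «NOT A STRENGTHENING»: Σ∞-ι ⟹ «ι-LOCUS»** (XiA `s2Qpsi_of_sigmas` :204–:209 verbatim): over the place of `ι`, ★ «Tok» `exists_cohToken_of_isHolOrAntihol_cpt`
gives an irreducible token `(M, σK, σ𝔤)` of `P` with `H¹_δ ≠ ⊥`, Σ∞-ι puts its class in `{jInf, dsInf}(p,q,t)`, and the two Prop. 15.2.1 clauses (★ `isCohTrivial_of_mem_posited`)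
force the locus.  AUDIT S2#A1 (on Σ∞-ι) therefore covers this letter a fortiori. [cite: Rogawski1990, §12.3 p. 178; Prop. 15.2.1 (b) p. 249] [cite: BorelWallach2000, VI Thm. 4.11] -/
theorem xiIotaLocus_of_archPacketIota (h : ArchPacketIotaLetter) : XiIotaLocusLetter := by
  obtain ⟨jInf, dsInf, hJ, hD, hmemι⟩ := h
  intro L _ _ _ ι H T hT hdef h2 μ _ μω hμu hμω P hP ξ hmem
  obtain ⟨M, _, _, σK, σ𝔤, hM, δ, hδ, hirr, htok, hne⟩ :=
    F0P3SLayerFoldShapes.exists_cohToken_of_isHolOrAntihol_cpt L ι H T hT μ hdef h2 P hP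
  have hx := hmemι L ι H T hT hdef h2 μ μω hμu hμω P hP M σK σ𝔤 hM hirr htok ξ hmem
  exact isCohTrivial_of_mem_posited hJ hD σK σ𝔤 hM hirr hx hδ hne

/-- **JUNCTION — the organ Ξ∞ `S2QpsiLetter` (LH1 leaf ED. 5 :328) from «ι-LOCUS» and Σ∞-cpt** (XiA `s2Qpsi_of_sigmas` :203–:215 with line :208 := the letter; the token block
:204–:207 disappears): over the place of `ι`, «ι-LOCUS» gives `ξ_ι ∈ Ξ_ι` and ★ `isCohTrivialAt_of_mk_eq` (odd type of record ★ `odd_archTypeOfRecord`) moves it to `τ ∈ {ι, ῑ}`;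
at `τ` off the place of `ι`, ★ `cmCompactFactor_rightRegular_eq_self_of_isHolOrAntihol` feeds Σ∞-cpt; ★ `q_eq_one_or_eq_neg_one_of_isCohTrivial` ends.  0 sorry, axioms TRIO.
[cite: Rogawski1990, §14.6 Thm. 14.6.4 p. 243; §12.3 p. 178; Prop. 15.2.1 (b) p. 249] [cite: Marshall2014, §3.3 ¶3; §3.4 ¶1; §4.1] -/
theorem s2Qpsi_of_locus (hloc : XiIotaLocusLetter) (hcpt : S2PinCompactLetter) : S2QpsiLetter := by
  intro L _ _ _ ι H T hT hdef h2 μ _ μω hμu hμω P hP ξ hmem τ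
  have hodd : ∀ w : InfinitePlace L, Odd (archTypeOfRecord μω w) := odd_archTypeOfRecord μω hμu hμω
  have hcoh : ξ.IsCohTrivialAt (ArchSignRecipe.tOfArchType (archTypeOfRecord μω) τ) τ := by
    by_cases hτ : InfinitePlace.mk τ = InfinitePlace.mk ι
    · -- over the place of `ι`: the letter «ι-LOCUS», transported `ι ↦ τ ∈ {ι, ῑ}`
      have hι : ξ.IsCohTrivialAt (ArchSignRecipe.tOfArchType (archTypeOfRecord μω) ι) ι :=
        hloc L ι H T hT hdef h2 μ μω hμu hμω P hP ξ hmem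
      exact isCohTrivialAt_of_mk_eq ξ (archTypeOfRecord μω) hodd ι hι τ hτ
    · -- a compact embedding: `K_c` fixes `P` (★), then Σ∞-cpt
      exact hcpt L ι H T hT hdef h2 μ μω hμu hμω P hP
        (F0P3CompactTrivOfRecord.cmCompactFactor_rightRegular_eq_self_of_isHolOrAntihol L ι H T hT P hP) ξ hmem τ hτ
  exact ArchSignRecipe.q_eq_one_or_eq_neg_one_of_isCohTrivial hcoh

/-- **HEAD `s2Qpsi_paid` — THE ORGAN Ξ∞ BY NAME from the two archimedean sockets {S7 «ι-LOCUS» `stub_R90_S7_xiIotaLocus`, S2 Σ∞-cpt `R90.S2.stub_R90_S2_archPacketCompact`}**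
(`#print axioms` = TRIO ∪ `sorryAx` through EXACTLY those two sockets; the term a ★ file restates to close `stub_S2qpsi` once both sockets are ★; Index R3's SECOND payer by name
after the Index pen re-points — HEADS §3). [cite: Rogawski1990, §14.6 Thm. 14.6.4 p. 243; §12.3 p. 178] [cite: Marshall2014, §4.1] -/
theorem s2Qpsi_paid : S2QpsiLetter :=
  s2Qpsi_of_locus stub_R90_S7_xiIotaLocus R90.S2.stub_R90_S2_archPacketCompact

/-- **READ-BACK — the old road FACTORS through the new letter**: Σ∞-ι + Σ∞-cpt ⟹ Ξ∞ via «ι-LOCUS» (XiA `s2Qpsi_of_sigmas` = `s2Qpsi_of_locus ∘ xiIotaLocus_of_archPacketIota`;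
TRIO). [cite: Rogawski1990, §14.6 Thm. 14.6.4 p. 243; §12.3 p. 178] -/
theorem s2Qpsi_of_sigmas_via_locus (h : ArchPacketIotaLetter) (hc : S2PinCompactLetter) : S2QpsiLetter :=
  s2Qpsi_of_locus (xiIotaLocus_of_archPacketIota h) hc

end Summit.HodgeConjecture.HodgeConjecture.R90.S7

end
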